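import Mathlib
import HarnessLib
import Summits.HubbardSuperconductivity.HubbardSuperconductivity.Theorems.KLProgrammeKLRegimeEngineScaleZeroTransfer
import Summits.HubbardSuperconductivity.HubbardSuperconductivity.Theorems.KLProgrammeKLRegimeEngineScaleZeroThetaPackage
import Summits.HubbardSuperconductivity.HubbardSuperconductivity.Theorems.KLProgrammeKLRegimeEngineV8DefsG8
import Summits.HubbardSuperconductivity.HubbardSuperconductivity.Theorems.KLProgrammeKLRegimeEngineScaleZeroValCPackage
import Summits.HubbardSuperconductivity.HubbardSuperconductivity.Theorems.KLProgrammeKLRegimeTwoPointLimitCooperResummation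

/-!
# K3 ENGINE-FLOW child (stmt-HubbardSuperconductivity-20437 `KLRegimeEngineV17F2`), v2 class #5 at scale `0`, part 3: the statement-stable CORE of the
# `n = 0` base — the floor of the transfer allowance, the scale-`0` smallness doors, and the norm clause for an ARBITRARY pinned weight

Cell `gate-hubbard-kl`, seat hubbard-kl-k3c2-p1 g5 (scale-`0` lane; plan g17 (R47p)/(P0), plan g18 (R54)(iv): «hold only the base's final STATEMENT line until the
`n = 0` value of the pinned weight is settled» — everything here is independent of that choice and of the class-#5 TEXT revision).

Class #5's carried invariant (`PairTransferFamilyCov`, p1 g11) asks at `n = 0`, for every smearing covariance `D` admissible at the bare frame `K₀ = klFlowFrameU … 0 = 0`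
and every pair class `Qm`: a transfer weight `t` (rev 1: `∃ t`; (R54) rev 2: a PINNED model weight), an inverse `Mt` of `1 − diag t·F₀` (`F₀ = klPairArrayF … 0 Qm`,
the bare-ball truncation of `𝒞₀`) and the straddle `‖𝒱₄(e^{Δ_D}𝒱₀)(Qm;k,k′) − (F₀·Mt)(k,k′)‖ ≤ transferBarAt … 0` on the bare ball.  AT SCALE `0` THIS IS PIN-INSENSITIVE:

* §1 `phGainOf_zero_zero_eq_one`, **`klEngGeo8_phGain_zero`** (`= 2^28`), **`transferBarAt_zero_ge`** (`2r·U² ≤ transferBarAt L G P r β U 0 Qm k k′` whenever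
  `1 ≤ G.phGain 0 ·`, `1 ≤ Klam`, `0 ≤ r`), **`klScaleZeroThetaC_mul_le_quarter_of_le_klEngU₀3`** (the `θ ≤ 1/4` of `…ScaleZeroTransfer`, below `klEngU₀3 ⊇ klEngU₀10`);
* §2 **`exists_rightInverse_one_sub_diagonal_mul`** (abstract: a SIGNED weight of mass `m` and an array with entries `≤ a`, `a·m ≤ 1/3` ⟹ a right inverse
  `Mt` of `1 − diag t·F` with the entries of `F·Mt` `≤ 3a/2` and `‖F·Mt − F‖_∞ ≤ (3a²/2)·m` — Neumann series in the max-row-sum norm of the TRANSPOSE,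
  p1's `klcr_neumann`; no repulsivity needed), **`norm_klPairArrayF_zero_le`** (`|F₀| ≤ 2U`), and **`pairTransfer_zero_normClause_of_weight`**: for EVERY
  weight `t` with `Σ|t| ≤ m`, `2U·m ≤ 1/3`: `∃ Mt, (1 − diag t·F₀)·Mt = 1 ∧ ‖𝒱₄(e^{Δ_D}𝒱₀)(Qm;k,k′) − (F₀·Mt)(k,k′)‖ ≤ (klTransferC R + 6m)·U²` on the bare ball
  (triangle inequality through the plain amplitude: the smearing transfer `klTransferC R·U²` of `…ScaleZeroTransfer` + `‖F₀Mt − F₀‖`).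
The final base statements (`PairTransferFamilyCov … 0` under rev 1, `PairTransferAtCov … 0 D` with the pinned weight under rev 2) are ONE application of
`pairTransfer_zero_normClause_of_weight` + `transferBarAt_zero_ge` and live in `…EnginePairTransferBase` (filed when the class-#5 text is final).

Bookkeeping and finite-dimensional linear algebra over the cited analytic theorems; nothing about the model is asserted beyond them; nothing asserts superconductivity.
-/

noncomputable section

namespace Summit.HubbardSuperconductivity.HubbardSuperconductivity.Theorems.EngineV8

set_option linter.dupNamespace false -- summit = problem name (single-conjunct summit), D-0017

open Real Finset Literature.MathematicalPhysics.QuantumLattice Literature.Probability.LatticeModels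
open Summit.HubbardSuperconductivity.HubbardSuperconductivity.Theorems.KLRegimeSplit
open Summit.HubbardSuperconductivity.HubbardSuperconductivity.Theorems.KLProgrammeLegKernels
open Summit.HubbardSuperconductivity.HubbardSuperconductivity.Theorems.ScaleZeroDecay

variable {L M : ℕ} [NeZero L]
/-! ## §1 The floor of the transfer allowance at scale `0`, and the smallness door -/

/-- **At scale `0` and width `0` the particle–hole gain profile is saturated**: `phGainOf C₀ K C₁ C₂ 0 e₀ 0 0 ρ = 1` whenever `1 ≤ C₀`, `0 ≤ K`, `0 ≤ C₁`,
`1 ≤ C₂·√e₀`, `0 < e₀`, `0 ≤ ρ` (both inner majorants are `≥ 1`, so the `min 1` cap bites). -/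
theorem phGainOf_zero_zero_eq_one {C₀ K C₁ C₂ e₀ ρ : ℝ} (hC₀ : 1 ≤ C₀) (hK : 0 ≤ K) (hC₁ : 0 ≤ C₁) (he₀ : 0 < e₀) (hC₂ : 1 ≤ C₂ * Real.sqrt e₀)
    (hρ : 0 ≤ ρ) : phGainOf C₀ K C₁ C₂ 0 e₀ 0 0 ρ = 1 := by
  unfold phGainOf
  have h1 : 1 ≤ C₀ * ((4 : ℝ) ^ 0)⁻¹ + K * (ρ + 0 * ((4 : ℝ) ^ 0)⁻¹) / e₀ * (4 : ℝ) ^ 0 := by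
    simp only [pow_zero, inv_one, mul_one, add_zero]
    have : 0 ≤ K * ρ / e₀ := by positivity
    linarith
  have h2 : 1 ≤ (if 0 * ((4 : ℝ) ^ 0)⁻¹ < ρ then C₁ * (e₀ * ((4 : ℝ) ^ 0)⁻¹) / (ρ - 0 * ((4 : ℝ) ^ 0)⁻¹) + C₂ * Real.sqrt e₀ * ((2 : ℝ) ^ 0)⁻¹
      else 1) := by
    split_ifs with h
    · simp only [pow_zero, inv_one, mul_one, sub_zero] at h ⊢
      have : 0 ≤ C₁ * e₀ / ρ := by positivity
      linarith
    · exact le_rfl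
  rw [min_eq_left (le_min h1 h2)]

/-- **The engine's geometry package at scale `0`: `klEngGeo8.phGain 0 ρ = 2^28`** for every `ρ` (`klEngGeo8.phGain = … = 2^28·phGainOf 2^24 2^24 2^24 2^24 0 e₀ n n (max ρ 0)`
through the `rfl` rows G8 → G7 → G6 → G5, and `phGainOf … 0 0 · = 1`). -/
theorem klEngGeo8_phGain_zero (ρ : ℝ) : klEngGeo8.phGain 0 ρ = 2 ^ 28 := by
  rw [klEngGeo8_phGain, klEngGeo7_phGain, klEngGeo6_phGain, klEngGeo5_phGain_apply]
  have he₀ : (0 : ℝ) < klE0 := by norm_num [klE0]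
  have hC₂ : (1 : ℝ) ≤ 2 ^ 24 * Real.sqrt klE0 := by
    have hs : (1 : ℝ) / 8 ≤ Real.sqrt klE0 := by
      rw [show (1 : ℝ) / 8 = Real.sqrt ((1 / 8) ^ 2) by rw [Real.sqrt_sq (by norm_num)]]
      exact Real.sqrt_le_sqrt (by norm_num [klE0])
    linarith
  rw [phGainOf_zero_zero_eq_one (by norm_num) (by norm_num) (by norm_num) he₀ hC₂ (le_max_right _ _), mul_one]

/-- `1 ≤ klEngGeo8.phGain 0 ρ`. -/
theorem one_le_klEngGeo8_phGain_zero (ρ : ℝ) : 1 ≤ klEngGeo8.phGain 0 ρ := by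
  rw [klEngGeo8_phGain_zero]; norm_num

omit [NeZero L] in
/-- **The floor of the transfer allowance at scale `0`**: for `G.WF` with `1 ≤ G.phGain 0 ·`, `P.WF` (`1 ≤ Klam`) and `0 ≤ r`:
`2·r·U² ≤ transferBarAt L G P r β U 0 Qm k k′` (the two saturated ph gains carry `2r(Klam U)²`; the `1/L`, cubic and thermal parts are nonnegative). -/
theorem transferBarAt_zero_ge {G : GeoConsts} (hG : G.WF) (hph : ∀ ρ, 1 ≤ G.phGain 0 ρ) {P : SplitConsts} (hP : P.WF) {r : ℝ} (hr : 0 ≤ r)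
    (β U : ℝ) (Qm k k' : TorusSite 2 L) : 2 * r * U ^ 2 ≤ transferBarAt L G P r β U 0 Qm k k' := by
  have hK : 1 ≤ P.Klam := hP.1
  have hCF : 0 ≤ G.CF := hG.2.2.2.2.2.2.2.2.2.2.2.2.2.1
  have hL : (0 : ℝ) ≤ ((L : ℝ))⁻¹ := by positivity
  have hth : 0 ≤ thermalBar G P U β 0 := by unfold thermalBar; positivity
  have hcube : 0 ≤ (P.Klam * |U|) ^ 3 * ((2 : ℝ) ^ 0)⁻¹ := by
    have : 0 ≤ P.Klam * |U| := mul_nonneg (by linarith) (abs_nonneg U)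
    positivity
  have h1 := hph (klTorusNorm L (k - k'))
  have h2 := hph (klTorusNorm L (k + k' - Qm))
  have hKU : U ^ 2 ≤ (P.Klam * U) ^ 2 := by
    rw [mul_pow]
    have hK2 : 1 ≤ P.Klam ^ 2 := one_le_pow₀ hK
    nlinarith [sq_nonneg U]
  unfold transferBarAt
  have hbr : 2 * U ^ 2 ≤ (P.Klam * U) ^ 2 * (G.phGain 0 (klTorusNorm L (k - k')) + G.phGain 0 (klTorusNorm L (k + k' - Qm)) + ((L : ℝ))⁻¹) +
      (P.Klam * |U|) ^ 3 * ((2 : ℝ) ^ 0)⁻¹ + thermalBar G P U β 0 := by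
    have : 2 * U ^ 2 ≤ (P.Klam * U) ^ 2 * (G.phGain 0 (klTorusNorm L (k - k')) + G.phGain 0 (klTorusNorm L (k + k' - Qm)) + ((L : ℝ))⁻¹) := by
      nlinarith [sq_nonneg (P.Klam * U)]
    linarith
  calc 2 * r * U ^ 2 = r * (2 * U ^ 2) := by ring
    _ ≤ _ := mul_le_mul_of_nonneg_left hbr hr

/-- **The scale-`0` smallness the transfer needs, below the engine threshold**: `R.WF`, `0 < U ≤ klEngU₀3 P R c` ⇒ `klScaleZeroThetaC R·U ≤ 1/4`
(the proof of `klScaleZeroThetaC_mul_le_half_of_le_klEngU₀3` gives `≤ 2⁻⁴²`). -/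
theorem klScaleZeroThetaC_mul_le_quarter_of_le_klEngU₀3 {P : SplitConsts} {R : RenConsts} (hR : R.WF) {c U : ℝ} (hU : 0 < U)
    (hU₀ : U ≤ klEngU₀3 P R c) : klScaleZeroThetaC R * U ≤ 1 / 4 := by
  have hG := hR.2.2
  have hθ := klScaleZeroThetaC_le (hG 0) (hG 2)
  have hRsq1 : 1 ≤ klEngRsq R := one_le_klEngRsq R
  have hPsq1 : 1 ≤ klEngPsq P := one_le_klEngPsq P
  have hG0 : R.Gfr 0 ≤ klEngRsq R := gfr_le_klEngRsq R (by norm_num)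
  have hG2 : R.Gfr 2 ≤ klEngRsq R := gfr_le_klEngRsq R (by norm_num)
  have hden : (2 : ℝ) ^ 120 * klEngRsq R ^ 4 ≤ (2 : ℝ) ^ 120 * klEngPsq P ^ 2 * klEngRsq R ^ 4 * (c ^ 2 + 1) := by
    have h2' : (1 : ℝ) ≤ klEngPsq P ^ 2 := one_le_pow₀ hPsq1
    have h3 : (1 : ℝ) ≤ c ^ 2 + 1 := by nlinarith [sq_nonneg c]
    have hR0 : 0 ≤ klEngRsq R ^ 4 := by positivity
    calc (2 : ℝ) ^ 120 * klEngRsq R ^ 4 = (2 : ℝ) ^ 120 * 1 * klEngRsq R ^ 4 * 1 := by ring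
      _ ≤ _ := by gcongr
  have hUle : U ≤ 1 / ((2 : ℝ) ^ 120 * klEngRsq R ^ 4) := by
    refine hU₀.trans ?_
    rw [klEngU₀3]
    exact one_div_le_one_div_of_le (by positivity) hden
  have hb : (R.Gfr 0 + 1) * (R.Gfr 2 + 1) ≤ 4 * klEngRsq R ^ 2 := by nlinarith [hG 0, hG 2]
  calc klScaleZeroThetaC R * U ≤ ((2 : ℝ) ^ 76 * (4 * klEngRsq R ^ 2)) * (1 / ((2 : ℝ) ^ 120 * klEngRsq R ^ 4)) :=
        mul_le_mul (hθ.trans (by nlinarith)) hUle hU.le (by positivity)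
    _ = 1 / ((2 : ℝ) ^ 42 * klEngRsq R ^ 2) := by field_simp; ring
    _ ≤ 1 / (2 : ℝ) ^ 42 := by
        refine one_div_le_one_div_of_le (by positivity) ?_
        have : (1 : ℝ) ≤ klEngRsq R ^ 2 := one_le_pow₀ hRsq1
        nlinarith
    _ ≤ 1 / 4 := by norm_num

/-! ## §2 Pin-insensitivity at scale `0`: the norm clause for an ARBITRARY pinned weight of small mass ((R54)) -/

section Pinned

open scoped Matrix.Norms.Operator
open Matrix Summit.HubbardSuperconductivity.HubbardSuperconductivity.Theorems.KLProgrammeCooperResummation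

omit [NeZero L] in
/-- **A right inverse of `1 − diag t·F` with controlled COLUMN sums, for a signed weight of small mass** (plain Neumann series in the
max-row-sum norm of the transpose; no repulsivity needed): if `‖F p q‖ ≤ a` entrywise (`0 ≤ a`), `Σ|t| ≤ m` and `a·m ≤ 1/3`, there is `Mt` with
`(1 − diag t·F)·Mt = 1`, every entry of `F·Mt` of modulus `≤ 3a/2`, and `‖(F·Mt)(k,k′) − F(k,k′)‖ ≤ (3a²/2)·m`. -/
theorem exists_rightInverse_one_sub_diagonal_mul {S : Type*} [Fintype S] [DecidableEq S] [Nonempty S] (t : S → ℝ) (F : Matrix S S ℂ) {a m : ℝ}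
    (ha : 0 ≤ a) (hF : ∀ p q, ‖F p q‖ ≤ a) (hm : ∑ p, |t p| ≤ m) (ham : a * m ≤ 1 / 3) :
    ∃ Mt : Matrix S S ℂ, (1 - Matrix.diagonal (fun p => (t p : ℂ)) * F) * Mt = 1 ∧ (∀ p k', ‖(F * Mt) p k'‖ ≤ 3 / 2 * a) ∧
      ∀ k k', ‖(F * Mt) k k' - F k k'‖ ≤ 3 / 2 * a ^ 2 * m := by
  have hm0 : 0 ≤ m := le_trans (sum_nonneg fun p _ => abs_nonneg (t p)) hm
  set Dg : Matrix S S ℂ := Matrix.diagonal (fun p => (t p : ℂ)) with hDg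
  set X : Matrix S S ℂ := -(Dg * F).transpose with hX
  -- the max-row-sum norm of `X` is the max-column-sum of `diag t·F`
  have hXn : ‖X‖ ≤ 1 / 3 := by
    rw [hX, norm_neg]
    refine (klcr_norm_le_of_rows _ (by positivity : (0 : ℝ) ≤ a * m) fun i => ?_).trans ham
    calc ∑ j, ‖(Dg * F).transpose i j‖ = ∑ j, |t j| * ‖F j i‖ := by
          refine sum_congr rfl fun j _ => ?_
          rw [Matrix.transpose_apply, hDg, Matrix.diagonal_mul, norm_mul, Complex.norm_real, Real.norm_eq_abs]
      _ ≤ ∑ j, |t j| * a := sum_le_sum fun j _ => mul_le_mul_of_nonneg_left (hF j i) (abs_nonneg _)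
      _ = (∑ j, |t j|) * a := by rw [sum_mul]
      _ ≤ m * a := mul_le_mul_of_nonneg_right hm ha
      _ = a * m := mul_comm _ _
  obtain ⟨N, -, hN2, hNn, -⟩ := klcr_neumann X hXn
  refine ⟨N.transpose, ?_, ?_, ?_⟩
  · -- `(1 − Dg F)·Nᵀ = (N·(1 + X))ᵀ = 1`
    have h1X : (1 + X).transpose = 1 - Dg * F := by
      rw [Matrix.transpose_add, Matrix.transpose_one, hX, Matrix.transpose_neg, Matrix.transpose_transpose, sub_eq_add_neg]
    calc (1 - Dg * F) * N.transpose = ((N * (1 + X))).transpose := by rw [Matrix.transpose_mul, h1X]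
      _ = 1 := by rw [hN2, Matrix.transpose_one]
  · -- entries of `F·Nᵀ`: `Σ_q |F p q|·|N k' q| ≤ a·‖N‖ ≤ 3a/2`
    intro p k'
    rw [Matrix.mul_apply]
    calc ‖∑ q, F p q * N.transpose q k'‖ ≤ ∑ q, ‖F p q * N.transpose q k'‖ := norm_sum_le _ _
      _ ≤ ∑ q, a * ‖N k' q‖ := sum_le_sum fun q _ => by
          rw [norm_mul, Matrix.transpose_apply]; exact mul_le_mul_of_nonneg_right (hF p q) (norm_nonneg _)
      _ = a * ∑ q, ‖N k' q‖ := by rw [mul_sum]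
      _ ≤ a * (3 / 2) := mul_le_mul_of_nonneg_left ((klcr_row_sum_le_norm N k').trans hNn) ha
      _ = 3 / 2 * a := mul_comm _ _
  · -- `F·Nᵀ − F = F·(Nᵀ − 1) = F·Dg·F·Nᵀ`
    intro k k'
    have hcol : ∀ p, ‖(F * N.transpose) p k'‖ ≤ 3 / 2 * a := by
      intro p
      rw [Matrix.mul_apply]
      calc ‖∑ q, F p q * N.transpose q k'‖ ≤ ∑ q, ‖F p q * N.transpose q k'‖ := norm_sum_le _ _
        _ ≤ ∑ q, a * ‖N k' q‖ := sum_le_sum fun q _ => by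
            rw [norm_mul, Matrix.transpose_apply]; exact mul_le_mul_of_nonneg_right (hF p q) (norm_nonneg _)
        _ = a * ∑ q, ‖N k' q‖ := by rw [mul_sum]
        _ ≤ a * (3 / 2) := mul_le_mul_of_nonneg_left ((klcr_row_sum_le_norm N k').trans hNn) ha
        _ = 3 / 2 * a := mul_comm _ _
    have h1X : (1 + X).transpose = 1 - Dg * F := by
      rw [Matrix.transpose_add, Matrix.transpose_one, hX, Matrix.transpose_neg, Matrix.transpose_transpose, sub_eq_add_neg]
    have hinv : (1 - Dg * F) * N.transpose = 1 := by
      calc (1 - Dg * F) * N.transpose = ((N * (1 + X))).transpose := by rw [Matrix.transpose_mul, h1X]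
        _ = 1 := by rw [hN2, Matrix.transpose_one]
    -- `Nᵀ − 1 = Dg·F·Nᵀ`
    have hsub : N.transpose - 1 = Dg * F * N.transpose := by
      have h := hinv
      rw [sub_mul, one_mul, Matrix.mul_assoc] at h
      -- h : Nᵀ − Dg (F Nᵀ) = 1
      calc N.transpose - 1 = N.transpose - (N.transpose - Dg * (F * N.transpose)) := by rw [h]
        _ = Dg * F * N.transpose := by rw [Matrix.mul_assoc]; abel
    have hdiff : (F * N.transpose) k k' - F k k' = (F * (Dg * (F * N.transpose))) k k' := by
      rw [← Matrix.mul_assoc Dg, ← hsub, Matrix.mul_sub, Matrix.mul_one, Matrix.sub_apply]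
    rw [hdiff, Matrix.mul_apply]
    calc ‖∑ p, F k p * (Dg * (F * N.transpose)) p k'‖ ≤ ∑ p, ‖F k p * (Dg * (F * N.transpose)) p k'‖ := norm_sum_le _ _
      _ ≤ ∑ p, a * (|t p| * (3 / 2 * a)) := sum_le_sum fun p _ => by
          rw [norm_mul, hDg, Matrix.diagonal_mul, norm_mul, Complex.norm_real, Real.norm_eq_abs]
          exact mul_le_mul (hF k p) (mul_le_mul_of_nonneg_left (hcol p) (abs_nonneg _)) (by positivity) ha
      _ = 3 / 2 * a ^ 2 * ∑ p, |t p| := by rw [← mul_sum, ← sum_mul]; ring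
      _ ≤ 3 / 2 * a ^ 2 * m := mul_le_mul_of_nonneg_left hm (by positivity)

end Pinned

/-- **The entries of the scale-`0` bare-frame pair array are `≤ 2U`**: `0` off the bare ball; on it `|𝒞₀| ≤ U + klScaleZeroValC R·U² ≤ 2U`
(`norm_klPairAmplitude_zero_sub_le_sq`, p3; `klScaleZeroValC R·U ≤ 1`). -/
theorem norm_klPairArrayF_zero_le [NeZero M] {R : RenConsts} (hR : R.WF) {U : ℝ} (hU : 0 < U) (hU1 : U ≤ 1) {Nsc : ℕ} {μ β : ℝ}
    (hK : FrameOK R U Nsc μ (klFlowFrameU L M β U μ 0)) (hβ : klBetaMin ≤ β) (hβL : β ≤ L) (hβM : β ^ 3 ≤ (M : ℝ))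
    (hθ : klScaleZeroThetaC R * U ≤ 1 / 2) (hV : klScaleZeroValC R * U ≤ 1) (Qm p q : TorusSite 2 L) :
    ‖klPairArrayF L M β U μ 0 Qm p q‖ ≤ 2 * U := by
  by_cases hp : p ∈ klBall L μ 0
  · by_cases hq : q ∈ klBall L μ 0
    · rw [klPairArrayF_apply_of_mem L M β U μ 0 Qm hp hq, klFlowFrameU_zero]
      have h := norm_klPairAmplitude_zero_sub_le_sq (L := L) (M := M) hR hU hU1 hK hβ hβL hβM hθ Qm p q
      rw [klFlowFrameU_zero] at h
      have hUn : ‖(U : ℂ)‖ = U := by rw [Complex.norm_real, Real.norm_eq_abs, abs_of_pos hU]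
      have htri := norm_le_norm_add_norm_sub' (klPairAmplitude L M β U μ 0 0 Qm p q) (U : ℂ)
      have hsq : klScaleZeroValC R * U ^ 2 ≤ U := by nlinarith
      linarith [htri, h, hUn.le, hUn.ge]
    · rw [klPairArrayF_apply_of_not_mem_right L M β U μ 0 Qm p hq, norm_zero]; positivity
  · rw [klPairArrayF_apply_of_not_mem L M β U μ 0 Qm hp, norm_zero]; positivity

/-- **THE NORM CLAUSE OF THE SCALE-`0` TRANSFER FOR AN ARBITRARY PINNED WEIGHT OF SMALL MASS** ((R54) pin-insensitivity): for every signed weight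
`t` with `Σ|t| ≤ m` and `2U·m ≤ 1/3`, and every smearing covariance `D` admissible at `(K₀, 0)`: there is `Mt` with `(1 − diag t·F₀)·Mt = 1` and
`‖𝒱₄(e^{Δ_D}𝒱₀)(Qm;k,k′) − (F₀·Mt)(k,k′)‖ ≤ (klTransferC R + 6m)·U²` on the bare ball (`F₀ = klPairArrayF … 0 Qm`; triangle inequality through the PLAIN
amplitude: the smearing transfer `klTransferC R·U²` plus `‖F₀·Mt − F₀‖ ≤ (3/2)(2U)²·m`). -/
theorem pairTransfer_zero_normClause_of_weight [NeZero M] {R : RenConsts} (hR : R.WF) {U : ℝ} (hU : 0 < U) (hU1 : U ≤ 1) {Nsc : ℕ}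
    {μ β : ℝ} (hK : FrameOK R U Nsc μ (klFlowFrameU L M β U μ 0)) (hβ : klBetaMin ≤ β) (hβL : β ≤ L) (hβM : β ^ 3 ≤ (M : ℝ))
    (hθ : klScaleZeroThetaC R * U ≤ 1 / 4) (hV : klScaleZeroValC R * U ≤ 1) {D : Matrix (HubbardFieldIdx L M) (HubbardFieldIdx L M) ℂ}
    (hD : IsSoftSubCov L M β μ (klFlowFrameU L M β U μ 0) 0 D) (Qm : TorusSite 2 L) (t : TorusSite 2 L → ℝ) {m : ℝ}
    (hm : ∑ p, |t p| ≤ m) (hUm : 2 * U * m ≤ 1 / 3) :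
    ∃ Mt : Matrix (TorusSite 2 L) (TorusSite 2 L) ℂ, (1 - Matrix.diagonal (fun p => (t p : ℂ)) * klPairArrayF L M β U μ 0 Qm) * Mt = 1 ∧
      ∀ k ∈ klBall L μ 0, ∀ k' ∈ klBall L μ 0,
        ‖klCovSmearedPairAmplitude L M β U μ (klFlowFrameU L M β U μ 0) 0 D Qm k k' - (klPairArrayF L M β U μ 0 Qm * Mt) k k'‖ ≤
          (klTransferC R + 6 * m) * U ^ 2 := by
  have hF := norm_klPairArrayF_zero_le (L := L) (M := M) hR hU hU1 hK hβ hβL hβM (by linarith) hV Qm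
  obtain ⟨Mt, hinv, -, hdefect⟩ := exists_rightInverse_one_sub_diagonal_mul t (klPairArrayF L M β U μ 0 Qm) (by positivity : (0:ℝ) ≤ 2 * U)
    hF hm (by linarith)
  refine ⟨Mt, hinv, fun k hk k' hk' => ?_⟩
  have hsm := norm_klCovSmearedPairAmplitude_zero_sub_le_sq (L := L) (M := M) hR hU hU1 hK hβ hβL hβM hθ hD Qm k k'
  have hFk : klPairArrayF L M β U μ 0 Qm k k' = klPairAmplitude L M β U μ (klFlowFrameU L M β U μ 0) 0 Qm k k' :=
    klPairArrayF_apply_of_mem L M β U μ 0 Qm hk hk'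
  have hd := hdefect k k'
  rw [klFlowFrameU_zero] at hsm hFk ⊢
  calc ‖klCovSmearedPairAmplitude L M β U μ 0 0 D Qm k k' - (klPairArrayF L M β U μ 0 Qm * Mt) k k'‖
      ≤ ‖klCovSmearedPairAmplitude L M β U μ 0 0 D Qm k k' - klPairAmplitude L M β U μ 0 0 Qm k k'‖ +
          ‖(klPairArrayF L M β U μ 0 Qm * Mt) k k' - klPairArrayF L M β U μ 0 Qm k k'‖ := by
        rw [← hFk]
        have := norm_sub_le_norm_sub_add_norm_sub (klCovSmearedPairAmplitude L M β U μ 0 0 D Qm k k') (klPairArrayF L M β U μ 0 Qm k k')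
          ((klPairArrayF L M β U μ 0 Qm * Mt) k k')
        rw [norm_sub_rev (klPairArrayF L M β U μ 0 Qm k k')] at this
        exact this
    _ ≤ klTransferC R * U ^ 2 + 3 / 2 * (2 * U) ^ 2 * m := add_le_add hsm hd
    _ = (klTransferC R + 6 * m) * U ^ 2 := by ring

end Summit.HubbardSuperconductivity.HubbardSuperconductivity.Theorems.EngineV8

end
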